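import Mathlib
import Summits.RiemannHypothesis.RiemannHypothesis.Theorems.HandoffInertiaCount
import HarnessLib

/-!
# HANDOFF — WEYL / CAUCHY INTERLACING IN COUNTING FORM: how far a finite-rank, sign-indefinite perturbation can move the
# spectral counting function (cell rh-explicit, TRACK «HANDOFF», seat theory-2 gen12; FILE XII-z; finite-dimensional folklore)

HONEST FRAMING. Nothing in this file bears on the truth of RH; every statement is elementary real linear algebra (Weyl's
inequalities / Cauchy interlacing / Courant–Fischer, folklore), written for the spectral COUNTING FUNCTION `c ↦ #{i | λᵢ < c}` of a
real symmetric matrix (Mathlib's `Matrix.IsHermitian.eigenvalues`, with multiplicity) — the form in which the cell's ladder data is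
scored. DATA it speaks to (theory-2 gen11, DERIVED-CHECK single-lineage on cc-s2-3's cc6-hp case files, LADDER note (L3)): in the
ODD sector the q-deleted window section `G_S = G_F − N` interlaces the near-null ladder of the full form `G_F` STRICTLY, one
eigenvalue per gap (24/24 cells, 72/72 gaps — the rank-one LOWERING picture, XII-x/XII-x′ for the diagonal model); in the EVEN sector
the atom's diagonal RAISES the ladder and interlacing «fails» in 39/126 gaps, every failure an eigenvalue ABOVE its rung by ≤ ×1.22.
The kernel content here is what a perturbation of given SIGN STRUCTURE can and cannot do to the count, for ANY symmetric matrices: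
§1 COMPARISON OF INDICES (on Mathlib's `sigNeg`, via XII-y): `x·Px ≤ x·Ax` on a subspace `W` ⟹ `sigNeg(A) ≤ sigNeg(P) + codim W`
   (`sigNeg_add_finrank_le_sigNeg_add_card`; `sigNeg_mono`; certificate form `sigNeg_le_sigNeg_add_of_le_on_ker`).
§2 THE SHIFTED COUNT: `#{λᵢ(A) < c} = sigNeg(A − c·1)` (`card_eigenvalues_lt_eq_sigNeg`).
§3 WEYL, COUNTING FORM: `x·Bx ≤ x·Ax` off `m` vectors ⟹ `#{λᵢ(A) < c} ≤ #{λᵢ(B) < c} + m` for every `c`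
   (`card_eigenvalues_lt_le_of_le_on_ker`; `m = 0` monotonicity `card_eigenvalues_lt_mono`; forms equal off `m` vectors ⟹ counts
   differ by ≤ m either way `card_eigenvalues_lt_dist_le_of_eq_on_ker`); for `A − N` with `N ≥ 0` off `r` vectors and `≤ 0` off `p`
   vectors: `#{λ(A) < c} − r ≤ #{λ(A − N) < c} ≤ #{λ(A) < c} + p` (`card_eigenvalues_lt_sub_weyl`) — a sign-indefinite atom moves
   eigenvalues at most `p` rungs up and `r` rungs down.
§4 CAUCHY INTERLACING: lowering rank-one `A − t·v vᵀ` (`t ≥ 0`): `#{λ(A) < c} ≤ #{λ(A − t v vᵀ) < c} ≤ #{λ(A) < c} + 1`, i.e.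
   `λ_{k−1}(A) ≤ λ_k(A − t v vᵀ) ≤ λ_k(A)` (`card_eigenvalues_lt_interlace_sub`); raising `A + t·v vᵀ`: the mirror statement
   (`card_eigenvalues_lt_interlace_add`: an eigenvalue may sit ABOVE its rung, never above the next); rank-`m` lowering
   (`card_eigenvalues_lt_interlace_sub_sum`).
§5 CONSEQUENCES: at most `m` eigenvalues below the old bottom (`card_eigenvalues_lt_le_of_forall_le` — general form of XII-x's
   `eigenvalue_below_ladder_unique`); window counts (`card_lt_eq_card_lt_add_card_Ico`); AT MOST ONE eigenvalue of `A − t v vᵀ` in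
   each gap of `A`'s spectrum (`card_eigenvalues_mem_gap_le_one` — the weak, general form of «one eigenvalue per ladder gap»; XII-x's
   `eigenvalue_in_gap_unique` is the strict diagonal case), `≤ #{λ(A) ∈ [a,b)} + m` for rank `m` (`card_eigenvalues_mem_Ico_le_add`).
What is NOT here (DATA/MODEL): STRICT interlacing (needs live couplings — XII-x/XII-x′), the measured ×1.22 offsets, the sign
structure of the actual prime atom (its `±‖N‖` layer spectrum is the case files' content), anything infinite-dimensional or about
ζ. No `def`s. References (folklore): A.-L. Cauchy, Exercices de math. 4 (1829); H. Weyl, Math. Ann. 71 (1912) 441–479; R. Courant,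
Math. Z. 7 (1920) 1–57 — as read in Horn–Johnson, Matrix Analysis, Thms 4.3.1, 4.3.4, 4.3.8. Companions: XII-y `HandoffInertiaCount`
(imported: `sigNeg` toolkit and `sigNeg = #{λ < 0}`), XII-x `HandoffSecularPencil`, XII-x′ `HandoffSecularGaps`, XII-l `HandoffRankOnePencil`.
-/

set_option linter.dupNamespace false  -- the mandated namespace repeats `RiemannHypothesis`

open Matrix Finset Module QuadraticMap
open Summit.RiemannHypothesis.RiemannHypothesis.Theorems.HandoffInertiaCount

namespace Summit.RiemannHypothesis.RiemannHypothesis.Theorems.HandoffWeylCounting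

variable {n : Type*} [Fintype n] [DecidableEq n]

/-! ## §1 Comparison: a form that is smaller on a subspace of codimension m has index larger by at least … − m -/

/-- **COMPARISON OF INDICES.** If `x·Px ≤ x·Ax` for every `x` in a subspace `W`, then `sigNeg(A) + dim W ≤ sigNeg(P) + n`, i.e.
`sigNeg(A) ≤ sigNeg(P) + codim W`: a negative-definite subspace `V` for `A` meets `W` in dimension `≥ dim V − codim W`, and there
`P ≤ A < 0`. (`P = 0`: XII-y's `sigNeg_add_finrank_le`.) [folklore: the subspace-intersection step of Courant–Fischer / Weyl] -/
theorem sigNeg_add_finrank_le_sigNeg_add_card (A P : Matrix n n ℝ) (W : Submodule ℝ (n → ℝ))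
    (hW : ∀ x ∈ W, x ⬝ᵥ P *ᵥ x ≤ x ⬝ᵥ A *ᵥ x) :
    sigNeg A.toQuadraticForm' + finrank ℝ W ≤ sigNeg P.toQuadraticForm' + Fintype.card n := by
  obtain ⟨V, hVr, hV⟩ := exists_finrank_eq_sigNeg_and_negDef A.toQuadraticForm'
  have hdim : finrank ℝ V + finrank ℝ W ≤ finrank ℝ ↥(V ⊓ W) + Fintype.card n := by
    have h1 := Submodule.finrank_sup_add_finrank_inf_eq V W
    have h2 : finrank ℝ ↥(V ⊔ W) ≤ Fintype.card n := by
      simpa [finrank_fintype_fun_eq_card] using Submodule.finrank_le (V ⊔ W)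
    omega
  have hVW : ((-P.toQuadraticForm').restrict (V ⊓ W)).PosDef := by
    intro x hx
    have hx0 : (x : n → ℝ) ≠ 0 := fun h ↦ hx ((Submodule.coe_eq_zero).mp h)
    have hA : 0 < (-A.toQuadraticForm') x := by
      have h := hV ⟨x, x.2.1⟩ (fun h ↦ hx0 (by simpa using congrArg Subtype.val h))
      simpa [restrict_apply] using h
    rw [QuadraticMap.neg_apply, toQuadraticForm'_apply, neg_pos] at hA
    rw [restrict_apply, QuadraticMap.neg_apply, toQuadraticForm'_apply, neg_pos]
    exact (hW x x.2.2).trans_lt hA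
  have h3 := le_sigNeg_of_negDef P.toQuadraticForm' hVW
  omega

/-- **MONOTONICITY.** If `x·Px ≤ x·Ax` for all `x`, then `sigNeg(A) ≤ sigNeg(P)` (lowering a form can only add negative directions).
[folklore] -/
theorem sigNeg_mono (A P : Matrix n n ℝ) (h : ∀ x, x ⬝ᵥ P *ᵥ x ≤ x ⬝ᵥ A *ᵥ x) :
    sigNeg A.toQuadraticForm' ≤ sigNeg P.toQuadraticForm' := by
  have h1 := sigNeg_add_finrank_le_sigNeg_add_card A P ⊤ (fun x _ ↦ h x)
  rw [finrank_top, finrank_fintype_fun_eq_card] at h1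
  omega

variable {m : ℕ}

/-- Certificate form: if `x·Px ≤ x·Ax` for every `x` orthogonal to the `m` rows of `U`, then `sigNeg(A) ≤ sigNeg(P) + m`.
[folklore] -/
theorem sigNeg_le_sigNeg_add_of_le_on_ker (A P : Matrix n n ℝ) (U : Matrix (Fin m) n ℝ)
    (h : ∀ x, U *ᵥ x = 0 → x ⬝ᵥ P *ᵥ x ≤ x ⬝ᵥ A *ᵥ x) :
    sigNeg A.toQuadraticForm' ≤ sigNeg P.toQuadraticForm' + m := by
  have h1 := sigNeg_add_finrank_le_sigNeg_add_card A P (LinearMap.ker U.mulVecLin)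
    (fun x hx ↦ h x (by simpa [LinearMap.mem_ker] using hx))
  have h2 := card_le_finrank_ker_add U
  omega

/-! ## §2 Counting eigenvalues below a level: `#{λᵢ < c} = sigNeg(A − c·1)` -/

/-- **THE SHIFTED COUNT.** For a real symmetric `A` and any level `c`, the number of eigenvalues `< c` (with multiplicity, Mathlib's
`hA.eigenvalues`) is the negative index of the shifted form `x ↦ x·(A − c·1)x`. [folklore] -/
theorem card_eigenvalues_lt_eq_sigNeg {A : Matrix n n ℝ} (hA : A.IsHermitian) (c : ℝ) :
    Fintype.card {i // hA.eigenvalues i < c} = sigNeg (A - c • (1 : Matrix n n ℝ)).toQuadraticForm' := by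
  rw [sigNeg_eq_card_of_orthonormal_eigenvectors (A - c • (1 : Matrix n n ℝ)) (fun i ↦ ⇑(hA.eigenvectorBasis i))
    (fun i ↦ hA.eigenvalues i - c) (eigenvectorBasis_dotProduct hA) fun i ↦ by
      rw [sub_mulVec, smul_mulVec, one_mulVec, hA.mulVec_eigenvectorBasis i, sub_smul]]
  exact Fintype.card_congr (Equiv.subtypeEquivRight fun i ↦ sub_neg.symm)

/-- The shifted forms compare exactly as the unshifted ones: `x·(P − c1)x ≤ x·(A − c1)x ↔ x·Px ≤ x·Ax`. [folklore] -/
theorem dotProduct_sub_smul_one_mulVec (M : Matrix n n ℝ) (c : ℝ) (x : n → ℝ) :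
    x ⬝ᵥ (M - c • (1 : Matrix n n ℝ)) *ᵥ x = x ⬝ᵥ M *ᵥ x - c * (x ⬝ᵥ x) := by
  rw [sub_mulVec, smul_mulVec, one_mulVec, dotProduct_sub, dotProduct_smul, smul_eq_mul]

/-! ## §3 WEYL'S INEQUALITIES, COUNTING FORM: «B ≤ A off m directions ⟹ #{λ(A) < c} ≤ #{λ(B) < c} + m» -/

/-- **WEYL, COUNTING FORM.** For real symmetric `A`, `B`: if `x·Bx ≤ x·Ax` for every `x` orthogonal to the `m` rows of `U`, then
for every level `c`, `#{λᵢ(A) < c} ≤ #{λᵢ(B) < c} + m` (eigenvalues with multiplicity). `m = 0`: a smaller form has at least as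
many eigenvalues below every level (Weyl monotonicity); general `m`: a perturbation that is `≤ 0` off `m` directions can push at
most `m` eigenvalues up through any level. [folklore: H. Weyl, Math. Ann. 71 (1912); Courant–Fischer] -/
theorem card_eigenvalues_lt_le_of_le_on_ker {A B : Matrix n n ℝ} (hA : A.IsHermitian) (hB : B.IsHermitian) (U : Matrix (Fin m) n ℝ)
    (h : ∀ x, U *ᵥ x = 0 → x ⬝ᵥ B *ᵥ x ≤ x ⬝ᵥ A *ᵥ x) (c : ℝ) :
    Fintype.card {i // hA.eigenvalues i < c} ≤ Fintype.card {i // hB.eigenvalues i < c} + m := by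
  rw [card_eigenvalues_lt_eq_sigNeg hA c, card_eigenvalues_lt_eq_sigNeg hB c]
  refine sigNeg_le_sigNeg_add_of_le_on_ker _ _ U fun x hx ↦ ?_
  rw [dotProduct_sub_smul_one_mulVec, dotProduct_sub_smul_one_mulVec]
  linarith [h x hx]

/-- `m = 0`: **WEYL MONOTONICITY** — `x·Bx ≤ x·Ax` for all `x` ⟹ `#{λᵢ(A) < c} ≤ #{λᵢ(B) < c}` for every `c` (equivalently
`λ_k(B) ≤ λ_k(A)` for every `k` in sorted order). [folklore] -/
theorem card_eigenvalues_lt_mono {A B : Matrix n n ℝ} (hA : A.IsHermitian) (hB : B.IsHermitian)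
    (h : ∀ x, x ⬝ᵥ B *ᵥ x ≤ x ⬝ᵥ A *ᵥ x) (c : ℝ) :
    Fintype.card {i // hA.eigenvalues i < c} ≤ Fintype.card {i // hB.eigenvalues i < c} := by
  simpa using card_eigenvalues_lt_le_of_le_on_ker hA hB (m := 0) (fun _ _ ↦ (0 : ℝ)) (fun x _ ↦ h x) c

/-- **A RANK-≤-m PERTURBATION MOVES THE COUNT BY AT MOST m EITHER WAY**: if the forms of `A` and `B` AGREE on the joint orthogonal
complement of `m` vectors (e.g. `A − B` has rank `≤ m` with row space inside the span of those vectors), then for every level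
`|#{λᵢ(A) < c} − #{λᵢ(B) < c}| ≤ m`. [folklore] -/
theorem card_eigenvalues_lt_dist_le_of_eq_on_ker {A B : Matrix n n ℝ} (hA : A.IsHermitian) (hB : B.IsHermitian)
    (U : Matrix (Fin m) n ℝ) (h : ∀ x, U *ᵥ x = 0 → x ⬝ᵥ B *ᵥ x = x ⬝ᵥ A *ᵥ x) (c : ℝ) :
    Fintype.card {i // hA.eigenvalues i < c} ≤ Fintype.card {i // hB.eigenvalues i < c} + m ∧
      Fintype.card {i // hB.eigenvalues i < c} ≤ Fintype.card {i // hA.eigenvalues i < c} + m :=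
  ⟨card_eigenvalues_lt_le_of_le_on_ker hA hB U (fun x hx ↦ (h x hx).le) c,
    card_eigenvalues_lt_le_of_le_on_ker hB hA U (fun x hx ↦ (h x hx).ge) c⟩

/-- **WEYL FOR `A − N` WITH A SIGN-INDEFINITE `N`** (the even-sector atom: its diagonal RAISES the ladder, the rest lowers it): if
`N ≥ 0` off `r` vectors and `N ≤ 0` off `p` vectors (e.g. `N` has `≤ r` negative and `≤ p` positive eigenvalues), then for every
level `#{λᵢ(A) < c} ≤ #{λᵢ(A − N) < c} + r` and `#{λᵢ(A − N) < c} ≤ #{λᵢ(A) < c} + p`: eigenvalues of `A − N` sit at most `p`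
rungs ABOVE and at most `r` rungs BELOW where monotone interlacing would put them. [folklore] -/
theorem card_eigenvalues_lt_sub_weyl {A N : Matrix n n ℝ} (hA : A.IsHermitian) (hAN : (A - N).IsHermitian) {p r : ℕ}
    (Ur : Matrix (Fin r) n ℝ) (hNr : ∀ x, Ur *ᵥ x = 0 → 0 ≤ x ⬝ᵥ N *ᵥ x)
    (Up : Matrix (Fin p) n ℝ) (hNp : ∀ x, Up *ᵥ x = 0 → x ⬝ᵥ N *ᵥ x ≤ 0) (c : ℝ) :
    Fintype.card {i // hA.eigenvalues i < c} ≤ Fintype.card {i // hAN.eigenvalues i < c} + r ∧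
      Fintype.card {i // hAN.eigenvalues i < c} ≤ Fintype.card {i // hA.eigenvalues i < c} + p := by
  refine ⟨card_eigenvalues_lt_le_of_le_on_ker hA hAN Ur (fun x hx ↦ ?_) c,
    card_eigenvalues_lt_le_of_le_on_ker hAN hA Up (fun x hx ↦ ?_) c⟩
  · rw [sub_mulVec, dotProduct_sub]
    linarith [hNr x hx]
  · rw [sub_mulVec, dotProduct_sub]
    linarith [hNp x hx]

/-! ## §4 CAUCHY INTERLACING for a rank-one modification, counting form -/

omit [DecidableEq n] in
/-- The form of a multiple of `v vᵀ`: `x·(t·v vᵀ)x = t (v·x)²`. [folklore] -/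
theorem dotProduct_smul_vecMulVec_mulVec (t : ℝ) (v x : n → ℝ) :
    x ⬝ᵥ (t • vecMulVec v v) *ᵥ x = t * (v ⬝ᵥ x) ^ 2 := by
  rw [smul_mulVec, Matrix.vecMulVec_mulVec, op_smul_eq_smul, dotProduct_smul, dotProduct_smul, smul_eq_mul, smul_eq_mul,
    dotProduct_comm x v, pow_two]

omit [DecidableEq n] in
/-- `U x = 0` for the one-row matrix `U = (v)` means `v·x = 0`. [folklore] -/
theorem dotProduct_eq_zero_of_row_mulVec {v x : n → ℝ} (hx : (fun _ : Fin 1 ↦ v : Matrix (Fin 1) n ℝ) *ᵥ x = 0) : v ⬝ᵥ x = 0 := by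
  simpa [Matrix.mulVec, dotProduct, funext_iff] using hx

/-- **CAUCHY INTERLACING, LOWERING UPDATE** (`t ≥ 0`, `A − t·v vᵀ`; the odd-sector atom on the ladder): for every level `c`,
`#{λᵢ(A) < c} ≤ #{λᵢ(A − t v vᵀ) < c} ≤ #{λᵢ(A) < c} + 1` — every eigenvalue moves down (`m = 0`: the update is `≤ 0` as a
form) but never below the next lower eigenvalue of `A` (`m = 1`: the forms agree on `v⊥`); in sorted order
`λ_{k−1}(A) ≤ λ_k(A − t v vᵀ) ≤ λ_k(A)`. The general (non-diagonal, not-all-couplings-live, weak-inequality) form of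
XII-x/XII-x′'s «one eigenvalue per ladder gap». [folklore: Cauchy 1829; Weyl 1912] -/
theorem card_eigenvalues_lt_interlace_sub {A : Matrix n n ℝ} (hA : A.IsHermitian) (v : n → ℝ) {t : ℝ} (ht : 0 ≤ t)
    (hP : (A - t • vecMulVec v v).IsHermitian) (c : ℝ) :
    Fintype.card {i // hA.eigenvalues i < c} ≤ Fintype.card {i // hP.eigenvalues i < c} ∧
      Fintype.card {i // hP.eigenvalues i < c} ≤ Fintype.card {i // hA.eigenvalues i < c} + 1 := by
  refine ⟨card_eigenvalues_lt_mono hA hP (fun x ↦ ?_) c,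
    card_eigenvalues_lt_le_of_le_on_ker hP hA (fun _ : Fin 1 ↦ v) (fun x hx ↦ ?_) c⟩
  · rw [sub_mulVec, dotProduct_sub, dotProduct_smul_vecMulVec_mulVec, sub_le_self_iff]
    positivity
  · rw [sub_mulVec, dotProduct_sub, dotProduct_smul_vecMulVec_mulVec, dotProduct_eq_zero_of_row_mulVec hx]
    simp

/-- **CAUCHY INTERLACING, RAISING UPDATE** (`t ≥ 0`, `A + t·v vᵀ`; the even-sector atom's diagonal): for every level `c`,
`#{λᵢ(A + t v vᵀ) < c} ≤ #{λᵢ(A) < c} ≤ #{λᵢ(A + t v vᵀ) < c} + 1` — every eigenvalue moves up, never above the next higher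
eigenvalue of `A`: an eigenvalue may sit ABOVE its rung (the cell's even-sector «failures above the rung, ×≤1.22»), never above the
next one. [folklore] -/
theorem card_eigenvalues_lt_interlace_add {A : Matrix n n ℝ} (hA : A.IsHermitian) (v : n → ℝ) {t : ℝ} (ht : 0 ≤ t)
    (hP : (A + t • vecMulVec v v).IsHermitian) (c : ℝ) :
    Fintype.card {i // hP.eigenvalues i < c} ≤ Fintype.card {i // hA.eigenvalues i < c} ∧
      Fintype.card {i // hA.eigenvalues i < c} ≤ Fintype.card {i // hP.eigenvalues i < c} + 1 := by
  refine ⟨card_eigenvalues_lt_mono hP hA (fun x ↦ ?_) c,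
    card_eigenvalues_lt_le_of_le_on_ker hA hP (fun _ : Fin 1 ↦ v) (fun x hx ↦ ?_) c⟩
  · rw [add_mulVec, dotProduct_add, dotProduct_smul_vecMulVec_mulVec, le_add_iff_nonneg_right]
    positivity
  · rw [add_mulVec, dotProduct_add, dotProduct_smul_vecMulVec_mulVec, dotProduct_eq_zero_of_row_mulVec hx]
    simp

/-- **RANK-m INTERLACING**: for `A − Σᵢ tᵢ vᵢvᵢᵀ` with all `tᵢ ≥ 0` (m lowering directions — a rank-`m` «atom»), every
eigenvalue count moves down by between `0` and `m`: `#{λᵢ(A) < c} ≤ #{λᵢ(A − Σ tᵢvᵢvᵢᵀ) < c} ≤ #{λᵢ(A) < c} + m`. [folklore] -/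
theorem card_eigenvalues_lt_interlace_sub_sum {A : Matrix n n ℝ} (hA : A.IsHermitian) (V : Matrix (Fin m) n ℝ) (t : Fin m → ℝ)
    (ht : ∀ i, 0 ≤ t i) (hP : (A - ∑ i, t i • vecMulVec (V i) (V i)).IsHermitian) (c : ℝ) :
    Fintype.card {i // hA.eigenvalues i < c} ≤ Fintype.card {i // hP.eigenvalues i < c} ∧
      Fintype.card {i // hP.eigenvalues i < c} ≤ Fintype.card {i // hA.eigenvalues i < c} + m := by
  refine ⟨card_eigenvalues_lt_mono hA hP (fun x ↦ ?_) c,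
    card_eigenvalues_lt_le_of_le_on_ker hP hA V (fun x hx ↦ ?_) c⟩
  · rw [sub_mulVec, dotProduct_sub, sub_le_self_iff, ← mulVecLin_apply,
      show (∑ i, t i • vecMulVec (V i) (V i)).mulVecLin = ∑ i, (t i • vecMulVec (V i) (V i)).mulVecLin from by ext; simp,
      LinearMap.sum_apply, dotProduct_sum]
    exact Finset.sum_nonneg fun i _ ↦ by rw [mulVecLin_apply, dotProduct_smul_vecMulVec_mulVec]; exact mul_nonneg (ht i) (sq_nonneg _)
  · rw [sub_mulVec, sum_vecMulVec_mulVec_eq_zero V t hx, sub_zero]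

/-! ## §5 Consequences: at most m new eigenvalues below the old bottom; at most one per spectral gap -/

/-- **AT MOST m EIGENVALUES BELOW THE OLD BOTTOM.** If `x·Ax ≤ x·Px` off `m` vectors (e.g. `P = A − Σ_{i<m} tᵢvᵢvᵢᵀ`) and `c` is a
lower bound for the spectrum of `A`, then `P` has at most `m` eigenvalues below `c` — the general form of XII-x's
`eigenvalue_below_ladder_unique` (m = 1: the deleted window form has at most ONE eigenvalue below the full form's bottom rung).
[folklore] -/
theorem card_eigenvalues_lt_le_of_forall_le {A P : Matrix n n ℝ} (hA : A.IsHermitian) (hP : P.IsHermitian) (U : Matrix (Fin m) n ℝ)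
    (h : ∀ x, U *ᵥ x = 0 → x ⬝ᵥ A *ᵥ x ≤ x ⬝ᵥ P *ᵥ x) {c : ℝ} (hc : ∀ i, c ≤ hA.eigenvalues i) :
    Fintype.card {i // hP.eigenvalues i < c} ≤ m := by
  have h0 : Fintype.card {i // hA.eigenvalues i < c} = 0 :=
    Fintype.card_eq_zero_iff.mpr ⟨fun i ↦ absurd i.2 (not_lt.mpr (hc i.1))⟩
  have h1 := card_eigenvalues_lt_le_of_le_on_ker hP hA U h c
  omega

omit [DecidableEq n] in
/-- Counting in a window: for `a ≤ b`, `#{λᵢ < b} = #{λᵢ < a} + #{a ≤ λᵢ < b}`. [folklore] -/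
theorem card_lt_eq_card_lt_add_card_Ico (f : n → ℝ) {a b : ℝ} (hab : a ≤ b) :
    Fintype.card {i // f i < b} = Fintype.card {i // f i < a} + Fintype.card {i // a ≤ f i ∧ f i < b} := by
  classical
  rw [Fintype.card_subtype, Fintype.card_subtype, Fintype.card_subtype,
    ← Finset.card_filter_add_card_filter_not (s := Finset.univ.filter fun i ↦ f i < b) (fun i ↦ f i < a),
    Finset.filter_filter, Finset.filter_filter]
  congr 2
  · exact Finset.filter_congr fun i _ ↦ ⟨fun h ↦ h.2, fun h ↦ ⟨h.trans_le hab, h⟩⟩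
  · exact Finset.filter_congr fun i _ ↦ ⟨fun h ↦ ⟨not_lt.mp h.2, h.1⟩, fun h ↦ ⟨h.2, not_lt.mpr h.1⟩⟩

/-- **AT MOST ONE EIGENVALUE PER SPECTRAL GAP** (lowering rank-one update): if `A` has no eigenvalue in `[a, b)`, then
`P = A − t·v vᵀ` (`t ≥ 0`) has at most one eigenvalue in `[a, b)`. With `[a, b) = [λ_{k−1}(A), λ_k(A))` this is the weak form of
«one eigenvalue per ladder gap» (XII-x `eigenvalue_in_gap_unique` is the strict diagonal case). [folklore] -/
theorem card_eigenvalues_mem_gap_le_one {A : Matrix n n ℝ} (hA : A.IsHermitian) (v : n → ℝ) {t : ℝ} (ht : 0 ≤ t)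
    (hP : (A - t • vecMulVec v v).IsHermitian) {a b : ℝ} (hab : a ≤ b)
    (hgap : ∀ i, hA.eigenvalues i < a ∨ b ≤ hA.eigenvalues i) :
    Fintype.card {i // a ≤ hP.eigenvalues i ∧ hP.eigenvalues i < b} ≤ 1 := by
  have hAab : Fintype.card {i // a ≤ hA.eigenvalues i ∧ hA.eigenvalues i < b} = 0 := by
    refine Fintype.card_eq_zero_iff.mpr ⟨fun i ↦ ?_⟩
    rcases hgap i.1 with h | h
    · exact absurd i.2.1 (not_le.mpr h)
    · exact absurd i.2.2 (not_lt.mpr h)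
  have hA' := card_lt_eq_card_lt_add_card_Ico hA.eigenvalues hab
  have hP' := card_lt_eq_card_lt_add_card_Ico hP.eigenvalues hab
  have h1 := (card_eigenvalues_lt_interlace_sub hA v ht hP b).2
  have h2 := (card_eigenvalues_lt_interlace_sub hA v ht hP a).1
  omega

/-- The same for a rank-`m` lowering update: at most `m` eigenvalues of `A − Σ tᵢvᵢvᵢᵀ` in a gap of `A`'s spectrum, and in
general `#{λ(P) ∈ [a,b)} ≤ #{λ(A) ∈ [a,b)} + m`. [folklore] -/
theorem card_eigenvalues_mem_Ico_le_add {A : Matrix n n ℝ} (hA : A.IsHermitian) (V : Matrix (Fin m) n ℝ) (t : Fin m → ℝ)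
    (ht : ∀ i, 0 ≤ t i) (hP : (A - ∑ i, t i • vecMulVec (V i) (V i)).IsHermitian) {a b : ℝ} (hab : a ≤ b) :
    Fintype.card {i // a ≤ hP.eigenvalues i ∧ hP.eigenvalues i < b} ≤
      Fintype.card {i // a ≤ hA.eigenvalues i ∧ hA.eigenvalues i < b} + m := by
  have hA' := card_lt_eq_card_lt_add_card_Ico hA.eigenvalues hab
  have hP' := card_lt_eq_card_lt_add_card_Ico hP.eigenvalues hab
  have h1 := (card_eigenvalues_lt_interlace_sub_sum hA V t ht hP b).2
  have h2 := (card_eigenvalues_lt_interlace_sub_sum hA V t ht hP a).1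
  omega

end Summit.RiemannHypothesis.RiemannHypothesis.Theorems.HandoffWeylCounting
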